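import Summits.BirchSwinnertonDyer.BirchSwinnertonDyer.Theses.GenusKolyvaginAtTwo
import Summits.BirchSwinnertonDyer.BirchSwinnertonDyer.Theorems.GenusKolyvaginAtTwoMinimalTwinBSDTwoOddCutOfDeepWitness
import Summits.BirchSwinnertonDyer.BirchSwinnertonDyer.Theorems.GenusKolyvaginAtTwoMinimalTwinBSDTwoAnalyticTwin
import HarnessLib

/-!
# LINE 23 «twin_swap» v2.6 PROPOSAL «SUPPLY⁻ ON THE CUT» (SIX stubs: WALL row 1 · PRINT×6 · Q2 · SUPPLY⁻ · DIV′|offcut · NDIV′|offcut) on crux hTw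
# `MinimalTwinBSDTwo` (stmt-BirchSwinnertonDyer-22985, route `GenusKolyvaginAtTwo` rev 71) — a PROPOSAL workfile of seat `bsd-line-gk2-p2` g31,
# NOT registered (skeleton of record stays v2.5 `Lines/twin_swap.lean`; director (745): announce-before-verb).  Nothing here proves BSD, U₂, the wall,
# Q2, SUPPLY⁻, DIV′ or NDIV′.

WHAT CHANGED vs v2.5.  v2.5: U₂ ⟸ WALL row 1 + DIV′ + NDIV′ + PRINT×6 (two research stubs, each a one-sided divisibility at EVERY odd Heegner frame
with `2` split).  g31 (this seat, p808930–p810945): on the ODD `Δ < 0` HABITAT CUT (`C(W)` odd, an odd prime of multiplicative reduction,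
`ρ_{W,2^∞}` onto) (i) DIV′ is a kernel theorem modulo Q2 (the swapped Kolyvagin-B₂ engine), and (ii) the route's CLOSED lower half L_T
`PowDvdShaCardAtTwoRT` (no root-number binder) supplies NDIV′'s content from ONE DEEP KOLYVAGIN WITNESS.  Hence the split:
* ON the cut: **U₂ ⟸ WALL row 1 + PRINT + Q2 + SUPPLY⁻** (`TwinAnnihilation.minimalTwinBSDTwo_onOddNegCut_of_wall_of_witnessSupply_of_facts`, p810945),
  SUPPLY⁻ = `DeepWitnessSupplyNegAtTwo` below (per `W` one odd Heegner frame, an odd-`c` datum with `P(1)` of infinite order and its exact depth, a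
  globally minimal twin model inside budget `ord₂ C(Wd) ≤ 1`, and a square-free `n` of deep `Frob_∞` Kolyvagin primes with `P(n) ∉ 2W(K[n])`) = the
  `ε = −1` MIRROR of the route's K₄⁻ `K4Neg` (31526);
* OFF the cut: v2.5's road unchanged, with DIV′/NDIV′ RESTRICTED to off-cut curves (`HeegnerIndexUpperOffCutAtTwo`, `HeegnerIndexLowerOffCutAtTwo`:
  the v2.5 texts with the single binder `¬ OnOddNegHabitatCut W` inserted after `#Sel₂(W) = 2`).
So **hTw ⟸ WALL row 1 + PRINT×6 + Q2 (item 24880) + SUPPLY⁻ + DIV′|offcut + NDIV′|offcut** — six stubs; on the cut the only research stub is a supply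
statement in the currency of the route's own supply cruxes.  BSD is NOT proved by any of this.
-/

set_option linter.dupNamespace false -- `Summit.<P>.<Sub>` repeats `BirchSwinnertonDyer` (D-0017)

namespace Summit.BirchSwinnertonDyer.BirchSwinnertonDyer.Cruxes.MinimalTwinBSDTwo.TwinSwapV26

open scoped Classical NumberField

open Summit.BirchSwinnertonDyer.BirchSwinnertonDyer.Theses.GenusKolyvaginAtTwo
open WeierstrassCurve NumberField Literature.NumberTheory.EllipticCurves Literature.NumberTheory.EllipticCurves.ModularForms
open Summit.BirchSwinnertonDyer.BirchSwinnertonDyer.Theorems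
open Summit.BirchSwinnertonDyer.BirchSwinnertonDyer.Theorems.GenusExact.TwinSwap
open Summit.BirchSwinnertonDyer.BirchSwinnertonDyer.Theorems.GenusExact.TwinSwap.AnalyticTwin
  (swappedPairDescentAtTwo_shaDepth_anyTwin_of_facts)
open Summit.BirchSwinnertonDyer.BirchSwinnertonDyer.Theorems.GenusExact.TwinSwap.TwinAnnihilation
  (minimalTwinBSDTwo_onOddNegCut_of_wall_of_witnessSupply_of_facts)
open Summit.BirchSwinnertonDyer.BirchSwinnertonDyer.Theorems.GenusExact.TwinSwap.Ledger.Line25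
  (exists_kolyvaginHeegnerData_one_of_nonempty_modularParametrizationData not_isOfFinAddOrder_derivedPoint_one_of_rankOne_of_lValue_ne_zero)
open Summit.BirchSwinnertonDyer.BirchSwinnertonDyer.Theorems.KolyvaginAtTwo (exists_exactTwoDepth)
open Literature.NumberTheory.QuadraticFields.Quadratic (ncard_primesOver_two_eq_two_iff)

/-! ## The displayed Props -/

/-- S1′ · the ANCHOR (as in v2.5): BSD₂ for every non-CM globally minimal curve of analytic rank `0` (= WALL row 1 of route ByReductionTypeAtTwo). -/
def RankZeroBSDTwo : Prop :=
  ∀ (W : WeierstrassCurve ℚ) [W.IsElliptic] [W.IsGloballyMinimal], ¬ W.HasCM → W.analyticRank = 0 →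
    Literature.NumberTheory.EllipticCurves.BSDp W 2

/-- **The odd `Δ < 0` habitat cut** of a globally minimal `W/ℚ`: `Δ_W < 0`, odd Tamagawa product, `ρ_{W,2^n}` onto for all `n ≥ 1`, and an odd prime
of multiplicative reduction (the non-phantom input of the Kolyvagin engines at `2`). -/
def OnOddNegHabitatCut (W : WeierstrassCurve ℚ) [W.IsElliptic] : Prop :=
  W.Δ < 0 ∧ Odd W.tamagawaProduct ∧ (∀ n : ℕ, 0 < n → W.HasSurjectiveModNGaloisRep ((2 : ℤ) ^ n)) ∧
    ∃ v : IsDedekindDomain.HeightOneSpectrum (𝓞 ℚ), ((2 : ℕ) : 𝓞 ℚ) ∉ v.asIdeal ∧ ((W.conductorNorm ℤ : ℕ) : 𝓞 ℚ) ∈ v.asIdeal ∧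
      W.HasMultiplicativeReductionAt v

/-- **SUPPLY⁻ — the deep-witness supply for the rank-ONE member on the cut** (VERBATIM the `hSupply` binder of
`TwinAnnihilation.minimalTwinBSDTwo_onOddNegCut_of_wall_of_witnessSupply_of_facts`, p810945): for every `W` on the odd `Δ < 0` habitat cut with
`¬CM`, `r_an = 1`, `#Sel₂ = 2`: ONE imaginary quadratic `K` (`d_K` odd `≠ −3`, Heegner for `N_W`), a datum `Dt` with `Dt.c` odd, a conductor-`1` datum `d₁`
with `P(1)` of infinite order and its exact `2`-depth `M₀`, a globally minimal model `Wd ≅ W^{(d_K)}` with `ord₂ C(Wd) ≤ 1`, and a square-free `n` of DEEP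
Kolyvagin primes (Zhang-admissible at `2`, index `≥ 2`, `Frob_ℓ = Frob_∞`) with `P(n) ∉ 2W(K[n])`.  The `ε = −1` mirror of K₄⁻ `K4Neg`; OPEN (research). -/
def DeepWitnessSupplyNegAtTwo : Prop :=
  ∀ (W : WeierstrassCurve ℚ) [W.IsElliptic] [W.IsGloballyMinimal] [NeZero (W.conductorNorm ℤ)],
    ¬ W.HasCM → W.analyticRank = 1 → Nat.card (W.selmerGroup 2) = 2 → Odd W.tamagawaProduct → W.Δ < 0 →
    (∀ n : ℕ, 0 < n → W.HasSurjectiveModNGaloisRep ((2 : ℤ) ^ n)) →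
    (∃ v : IsDedekindDomain.HeightOneSpectrum (𝓞 ℚ), ((2 : ℕ) : 𝓞 ℚ) ∉ v.asIdeal ∧ ((W.conductorNorm ℤ : ℕ) : 𝓞 ℚ) ∈ v.asIdeal ∧
      W.HasMultiplicativeReductionAt v) →
    ∃ (K : Type) (_ : Field K) (_ : NumberField K), IsImaginaryQuadratic K ∧ Odd (NumberField.discr K) ∧ NumberField.discr K ≠ -3 ∧
      SatisfiesHeegnerHypothesis (W.conductorNorm ℤ) K ∧
      ∃ (Dt : ModularParametrizationData W (W.conductorNorm ℤ)) (β : ℤ) (ι : K →+* ℂ) (d₁ : KolyvaginHeegnerData Dt β ι 1) (M₀ : ℕ),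
        Odd Dt.c ∧ ¬ IsOfFinAddOrder d₁.derivedPoint ∧
        (∃ Q : (W.baseChange (ringClassField K ι 1)).toAffine.Point, ((2 ^ M₀ : ℕ) : ℤ) • Q = d₁.derivedPoint) ∧
        (¬ ∃ Q : (W.baseChange (ringClassField K ι 1)).toAffine.Point, ((2 ^ (M₀ + 1) : ℕ) : ℤ) • Q = d₁.derivedPoint) ∧
        (∃ (Wd : WeierstrassCurve ℚ) (_ : Wd.IsElliptic) (_ : Wd.IsGloballyMinimal),
          (∃ C : VariableChange ℚ, C • W.quadraticTwist (NumberField.discr K : ℚ) = Wd) ∧ padicValNat 2 Wd.tamagawaProduct ≤ 1) ∧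
        ∃ (n : ℕ) (d : KolyvaginHeegnerData Dt β ι n), Squarefree n ∧
          (∀ ℓ ∈ n.primeFactors, Zhang2014.IsKolyvaginPrime (W.conductorNorm ℤ) W K 2 ℓ ∧ 2 ≤ Zhang2014.kolyvaginIndex W 2 ℓ ∧
            FrobEqFrobInfty W K 2 ℓ) ∧
          ¬ ∃ Q : (W.baseChange (ringClassField K ι n)).toAffine.Point, (2 : ℤ) • Q = d.derivedPoint

/-- DIV′|offcut · v2.5's `HeegnerIndexUpperAnyTwinAtTwo` VERBATIM with the single binder `¬ OnOddNegHabitatCut W` inserted after `#Sel₂(W) = 2` (on the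
cut DIV′ is this seat's kernel theorem `heegnerIndexUpper_conclusion_onOddNegCut`, mod Q2 + GZK, inside the budget). -/
def HeegnerIndexUpperOffCutAtTwo : Prop :=
  ∀ (W : WeierstrassCurve ℚ) [W.IsElliptic] [W.IsGloballyMinimal] [NeZero (W.conductorNorm ℤ)],
    ¬ W.HasCM → W.analyticRank = 1 → Nat.card (W.selmerGroup 2) = 2 → ¬ OnOddNegHabitatCut W →
    ∀ (K : Type) [Field K] [NumberField K], IsImaginaryQuadratic K →
      Odd (NumberField.discr K) → NumberField.discr K ≠ -3 → SatisfiesHeegnerHypothesis (W.conductorNorm ℤ) K →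
      ((Ideal.span {(2 : ℤ)}).primesOver (𝓞 K)).ncard = 2 →
      ∀ (Wd : WeierstrassCurve ℚ) [Wd.IsElliptic] [Wd.IsGloballyMinimal],
        (∃ C : VariableChange ℚ, C • W.quadraticTwist (NumberField.discr K : ℚ) = Wd) →
      (W.quadraticTwist (NumberField.discr K : ℚ)).entireLFunction 1 ≠ 0 →
      ∀ (Dt : ModularParametrizationData W (W.conductorNorm ℤ)) (β : ℤ) (ι : K →+* ℂ) (d₁ : KolyvaginHeegnerData Dt β ι 1) (M₀ : ℕ),
        (∃ Q : (W.baseChange (ringClassField K ι 1)).toAffine.Point, ((2 ^ M₀ : ℕ) : ℤ) • Q = d₁.derivedPoint) →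
        (¬ ∃ Q : (W.baseChange (ringClassField K ι 1)).toAffine.Point, ((2 ^ (M₀ + 1) : ℕ) : ℤ) • Q = d₁.derivedPoint) →
          Nat.card (AddCommGroup.primaryComponent (W.baseChange K).sha 2) *
              2 ^ (2 * (padicValInt 2 Dt.c + padicValNat 2 W.tamagawaProduct)) ∣ 2 ^ (2 * M₀)

/-- NDIV′|offcut · v2.5's `HeegnerIndexLowerAnyTwinAtTwo` VERBATIM with the single binder `¬ OnOddNegHabitatCut W` inserted after `#Sel₂(W) = 2`. -/
def HeegnerIndexLowerOffCutAtTwo : Prop :=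
  ∀ (W : WeierstrassCurve ℚ) [W.IsElliptic] [W.IsGloballyMinimal] [NeZero (W.conductorNorm ℤ)],
    ¬ W.HasCM → W.analyticRank = 1 → Nat.card (W.selmerGroup 2) = 2 → ¬ OnOddNegHabitatCut W →
    ∀ (K : Type) [Field K] [NumberField K], IsImaginaryQuadratic K →
      Odd (NumberField.discr K) → NumberField.discr K ≠ -3 → SatisfiesHeegnerHypothesis (W.conductorNorm ℤ) K →
      ((Ideal.span {(2 : ℤ)}).primesOver (𝓞 K)).ncard = 2 →
      ∀ (Wd : WeierstrassCurve ℚ) [Wd.IsElliptic] [Wd.IsGloballyMinimal],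
        (∃ C : VariableChange ℚ, C • W.quadraticTwist (NumberField.discr K : ℚ) = Wd) →
      (W.quadraticTwist (NumberField.discr K : ℚ)).entireLFunction 1 ≠ 0 →
      ∀ (Dt : ModularParametrizationData W (W.conductorNorm ℤ)) (β : ℤ) (ι : K →+* ℂ) (d₁ : KolyvaginHeegnerData Dt β ι 1) (M₀ : ℕ),
        (∃ Q : (W.baseChange (ringClassField K ι 1)).toAffine.Point, ((2 ^ M₀ : ℕ) : ℤ) • Q = d₁.derivedPoint) →
        (¬ ∃ Q : (W.baseChange (ringClassField K ι 1)).toAffine.Point, ((2 ^ (M₀ + 1) : ℕ) : ℤ) • Q = d₁.derivedPoint) →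
          2 ^ (2 * M₀) ∣ Nat.card (AddCommGroup.primaryComponent (W.baseChange K).sha 2) *
              2 ^ (2 * (padicValInt 2 Dt.c + padicValNat 2 W.tamagawaProduct))

/-! ## The six stubs -/

/-- stub WALL = items 19095–19098 of route ByReductionTypeAtTwo (WALL row 1) BY NAME — the anchor (as in v2.5). -/
theorem stub_wallRankZeroAtTwo :
    Summit.BirchSwinnertonDyer.BirchSwinnertonDyer.Theses.ByReductionTypeAtTwo.GoodOrdinaryRankZeroAtTwo ∧
      Summit.BirchSwinnertonDyer.BirchSwinnertonDyer.Theses.ByReductionTypeAtTwo.MultiplicativeRankZeroAtTwo ∧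
      Summit.BirchSwinnertonDyer.BirchSwinnertonDyer.Theses.ByReductionTypeAtTwo.SupersingularRankZeroAtTwo ∧
      Summit.BirchSwinnertonDyer.BirchSwinnertonDyer.Theses.ByReductionTypeAtTwo.AdditiveRankZeroAtTwo := by
  sorry

/-- stub PRINT = the route's four print items BY NAME + BCDT + Friedberg–Hoffstein (as in v2.5). -/
theorem stub_printFacts :
    GrossZagierAllLevels ∧ MultPublishedInputsAtTwo ∧ EntireLFunctionRat ∧ MilneAnyModel ∧ nonempty_modularParametrizationData ∧
      friedbergHoffstein_exists_heegnerField_split_twist_ne_zero := by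
  sorry

/-- stub Q2 = item stmt-BirchSwinnertonDyer-24880 `KolyvaginRelationAtTwo` BY NAME (McCallum Prop. 4.4 at `2`; the antecedent of every Kolyvagin
engine of the route). -/
theorem stub_kolyvaginRelationAtTwo : KolyvaginRelationAtTwo := by
  sorry

/-- stub SUPPLY⁻ — the deep-witness supply for the rank-one member on the cut (research; `ε = −1` mirror of K₄⁻). -/
theorem stub_deepWitnessSupplyNeg : DeepWitnessSupplyNegAtTwo := by
  sorry

/-- stub DIV′|offcut — the upper half off the cut (research; v2.5's DIV′ restricted). -/
theorem stub_heegnerIndexUpperOffCut : HeegnerIndexUpperOffCutAtTwo := by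
  sorry

/-- stub NDIV′|offcut — the lower half off the cut (research; v2.5's NDIV′ restricted). -/
theorem stub_heegnerIndexLowerOffCut : HeegnerIndexLowerOffCutAtTwo := by
  sorry

/-! ## Closed pieces -/

/-- WALL row 1 ⟹ S1′ (as in v2.5). -/
theorem rankZeroBSDTwo_of_wall (hOrd : Summit.BirchSwinnertonDyer.BirchSwinnertonDyer.Theses.ByReductionTypeAtTwo.GoodOrdinaryRankZeroAtTwo)
    (hMult : Summit.BirchSwinnertonDyer.BirchSwinnertonDyer.Theses.ByReductionTypeAtTwo.MultiplicativeRankZeroAtTwo)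
    (hSS : Summit.BirchSwinnertonDyer.BirchSwinnertonDyer.Theses.ByReductionTypeAtTwo.SupersingularRankZeroAtTwo)
    (hAdd : Summit.BirchSwinnertonDyer.BirchSwinnertonDyer.Theses.ByReductionTypeAtTwo.AdditiveRankZeroAtTwo) : RankZeroBSDTwo := by
  intro W _ _ hCM hr
  by_cases hg : W.HasGoodReductionAtPrime 2
  · by_cases hd : ((2 : ℕ) : ℤ) ∣ W.frobeniusTrace 2
    · exact hSS W hCM hr ⟨hg, hd⟩
    · exact hOrd W hCM hr ⟨hg, hd⟩
  · by_cases hm : W.HasMultiplicativeReductionAtPrime 2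
    · exact hMult W hCM hr hm
    · exact hAdd W hCM hr ⟨hg, hm⟩

/-- **OFF THE CUT: v2.5's road, one curve at a time.**  For a single `W` off the cut: S1′ + DIV′|offcut + NDIV′|offcut + PRINT×6 ⟹ `BSD₂(W)` — the body of
g27's `AnalyticTwin.bsdp_of_wall_of_friedbergHoffstein_of_kex_of_facts` with KEX′ replaced by the two restricted halves at the Friedberg–Hoffstein frame
(the exact `2`-depth of the non-torsion `P(1)` exists; `Nat.dvd_antisymm`).  CONDITIONAL on the displayed hypotheses; proves nothing about BSD. -/
theorem bsdp_offCut_of_wall_of_halves_of_facts (h1 : RankZeroBSDTwo) (hU : HeegnerIndexUpperOffCutAtTwo) (hL : HeegnerIndexLowerOffCutAtTwo)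
    (hGZ : GrossZagierAllLevels) (hGZK : MultPublishedInputsAtTwo) (hmod : EntireLFunctionRat) (hMilneC : MilneAnyModel)
    (hMP : nonempty_modularParametrizationData) (hFH : friedbergHoffstein_exists_heegnerField_split_twist_ne_zero)
    (W : WeierstrassCurve ℚ) [W.IsElliptic] [W.IsGloballyMinimal] (hcm : ¬ W.HasCM) (hr : W.analyticRank = 1)
    (hSel : Nat.card (W.selmerGroup 2) = 2) (hoff : ¬ OnOddNegHabitatCut W) : BSDp W 2 := by
  haveI : NeZero (W.conductorNorm ℤ) := ⟨(W.conductorNorm_pos_holds).ne'⟩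
  obtain ⟨Dt₀⟩ := hMP W
  have hw : W.rootNumber = -1 := by
    rcases Literature.NumberTheory.EllipticCurves.rootNumber_eq_one_or_eq_neg_one W with h | h
    · exfalso
      have hev : Even W.analyticRank :=
        (Literature.Barriers.BirchSwinnertonDyer.even_analyticRank_iff_of_isNewformOf_conductorLevel Dt₀.isNewformOf).mpr h
      rw [hr] at hev
      exact Nat.not_even_one hev
    · exact h
  -- Friedberg–Hoffstein: a Heegner field with `2` split, `|d_K| > 4`, `L(W^{(d_K)},1) ≠ 0`
  obtain ⟨K, _, _, hK, hB, hH, h2H, hLv⟩ := hFH W hw 2 Nat.prime_two 4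
  have h2 : Module.finrank ℚ K = 2 := hK.1
  have h2K : ((Ideal.span {(2 : ℤ)}).primesOver (𝓞 K)).ncard = 2 := by
    simpa using h2H 2 Nat.prime_two (dvd_refl 2)
  have hodd : Odd (NumberField.discr K) := by
    have h8 := (ncard_primesOver_two_eq_two_iff (K := K) h2).mp h2K
    rw [Int.odd_iff]; omega
  have h3 : NumberField.discr K ≠ -3 := by
    intro h; rw [h] at hB; simp at hB
  have hD0 : (NumberField.discr K : ℚ) ≠ 0 := by exact_mod_cast NumberField.discr_ne_zero K
  haveI := W.isElliptic_quadraticTwist hD0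
  obtain ⟨Cd, hmin⟩ := hasGlobalMinimalModel_rat_holds (W.quadraticTwist (NumberField.discr K : ℚ))
  haveI := hmin
  -- a conductor-1 datum and its Heegner point of infinite order
  obtain ⟨Dt, β, ι, d₁, hc0⟩ := exists_kolyvaginHeegnerData_one_of_nonempty_modularParametrizationData hMP W K hK hH
  have hy : ¬ IsOfFinAddOrder d₁.derivedPoint :=
    not_isOfFinAddOrder_derivedPoint_one_of_rankOne_of_lValue_ne_zero hmod W K (hGZ _ W K) hK hH hr hLv d₁
  -- the exact `2`-depth of `P(1)` exists (Mordell–Weil over `K[1]` + Krull)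
  haveI := (finiteDimensional_and_isGalois_ringClassField hK ι one_ne_zero).1
  haveI : NumberField (ringClassField K ι 1) := NumberField.of_module_finite K _
  haveI : (W.baseChange (ringClassField K ι 1)).IsElliptic := by rw [baseChange]; infer_instance
  haveI : Module.Finite ℤ (W.baseChange (ringClassField K ι 1)).toAffine.Point := by
    convert (W.baseChange (ringClassField K ι 1)).module_finite_point_holds
  obtain ⟨M₀, hdiv, hndiv⟩ := exists_exactTwoDepth
    (A := (W.baseChange (ringClassField K ι 1)).toAffine.Point) (y := d₁.derivedPoint) (by convert hy)
  -- the two restricted halves at this frame give the exactness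
  have hsha : Nat.card (AddCommGroup.primaryComponent (W.baseChange K).sha 2) *
      2 ^ (2 * (padicValInt 2 Dt.c + padicValNat 2 W.tamagawaProduct)) = 2 ^ (2 * M₀) :=
    Nat.dvd_antisymm
      (hU W hcm hr hSel hoff K hK hodd h3 hH h2K (Cd • W.quadraticTwist (NumberField.discr K : ℚ)) ⟨Cd, rfl⟩ hLv Dt β ι d₁ M₀ hdiv hndiv)
      (hL W hcm hr hSel hoff K hK hodd h3 hH h2K (Cd • W.quadraticTwist (NumberField.discr K : ℚ)) ⟨Cd, rfl⟩ hLv Dt β ι d₁ M₀ hdiv hndiv)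
  -- the twin is non-CM of analytic rank 0: `BSD₂(Wd)` from the wall
  have hcmd : ¬ (Cd • W.quadraticTwist (NumberField.discr K : ℚ)).HasCM := by
    rw [hasCM_iff_of_j_eq (((W.quadraticTwist (NumberField.discr K : ℚ)).variableChange_j Cd).trans (W.j_quadraticTwist hD0))]
    exact hcm
  have hrd : (Cd • W.quadraticTwist (NumberField.discr K : ℚ)).analyticRank = 0 := by
    rw [analyticRank_smul]
    exact ((W.quadraticTwist (NumberField.discr K : ℚ)).analyticRank_eq_zero_iff_holds (hmod _)).mpr hLv
  have hBd : BSDp (Cd • W.quadraticTwist (NumberField.discr K : ℚ)) 2 := h1 _ hcmd hrd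
  exact swappedPairDescentAtTwo_shaDepth_anyTwin_of_facts hGZ hGZK hmod hMilneC W hr hSel K hK hodd h3 hH Dt hc0 β ι d₁ hy M₀ hdiv hndiv hsha
    (Cd • W.quadraticTwist (NumberField.discr K : ℚ)) ⟨Cd, rfl⟩ hBd

/-! ## The composition -/

/-- COMPOSITION v2.6 with displayed inputs (no sorry of its own): S1′ + PRINT×6 + Q2 + SUPPLY⁻ + DIV′|offcut + NDIV′|offcut prove hTw, by cases on the cut:
ON the cut by this seat's `TwinAnnihilation.minimalTwinBSDTwo_onOddNegCut_of_wall_of_witnessSupply_of_facts` (p810945), OFF the cut by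
`bsdp_offCut_of_wall_of_halves_of_facts`. -/
theorem minimalTwinBSDTwo_of_inputs (h1 : RankZeroBSDTwo) (hQ2 : KolyvaginRelationAtTwo) (hSup : DeepWitnessSupplyNegAtTwo)
    (hU : HeegnerIndexUpperOffCutAtTwo) (hL : HeegnerIndexLowerOffCutAtTwo)
    (hGZ : GrossZagierAllLevels) (hGZK : MultPublishedInputsAtTwo) (hmod : EntireLFunctionRat) (hMilneC : MilneAnyModel)
    (hMP : nonempty_modularParametrizationData) (hFH : friedbergHoffstein_exists_heegnerField_split_twist_ne_zero) :
    ∀ (W : WeierstrassCurve ℚ) [W.IsElliptic] [W.IsGloballyMinimal],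
      ¬ W.HasCM → W.analyticRank = 1 → Nat.card (W.selmerGroup 2) = 2 → Literature.NumberTheory.EllipticCurves.BSDp W 2 := by
  intro W _ _ hcm hr hSel
  by_cases hcut : OnOddNegHabitatCut W
  · haveI : NeZero (W.conductorNorm ℤ) := ⟨(W.conductorNorm_pos_holds).ne'⟩
    obtain ⟨hneg, hT, hρ, hv⟩ := hcut
    exact minimalTwinBSDTwo_onOddNegCut_of_wall_of_witnessSupply_of_facts hQ2 hGZ hGZK hmod hMilneC h1 hSup W hcm hr hSel hT hneg hρ hv
  · exact bsdp_offCut_of_wall_of_halves_of_facts h1 hU hL hGZ hGZK hmod hMilneC hMP hFH W hcm hr hSel hcut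

/-- **THE LINE CONCLUDES THE CRUX BY NAME**: `MinimalTwinBSDTwo` (stmt-BirchSwinnertonDyer-22985) from the six stubs.  Sorry-free outside the stubs. -/
theorem MinimalTwinBSDTwo_of : Summit.BirchSwinnertonDyer.BirchSwinnertonDyer.Theses.GenusKolyvaginAtTwo.MinimalTwinBSDTwo :=
  minimalTwinBSDTwo_of_inputs
    (rankZeroBSDTwo_of_wall stub_wallRankZeroAtTwo.1 stub_wallRankZeroAtTwo.2.1 stub_wallRankZeroAtTwo.2.2.1 stub_wallRankZeroAtTwo.2.2.2)
    stub_kolyvaginRelationAtTwo stub_deepWitnessSupplyNeg stub_heegnerIndexUpperOffCut stub_heegnerIndexLowerOffCut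
    stub_printFacts.1 stub_printFacts.2.1 stub_printFacts.2.2.1 stub_printFacts.2.2.2.1 stub_printFacts.2.2.2.2.1 stub_printFacts.2.2.2.2.2

end Summit.BirchSwinnertonDyer.BirchSwinnertonDyer.Cruxes.MinimalTwinBSDTwo.TwinSwapV26
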